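import Literature.Topology.FourManifolds.FishtailParamsGlue
import HarnessLib

/-!
# The reference tube about Gompf's disc

Infrastructure for the explicit fishtail neighbourhood (R. Gompf, *More Cappell–Shaneson spheres
are standard*, Algebr. Geom. Topol. 10 (2010), proof of Thm 2.1 and Lemma 2.2; the named fact
`Literature.Topology.FourManifolds.gompf2010_framedTwist`). The reference tube data
`fishTref ε hε hε2` (handle scale `1`, leg radius `L_c`, no un-shearing) do not depend on the
leg radius `ρ_b`. Here: the leg piece with `μ = 0` is a local diffeomorphism at every offset
(also at `w = 0`), the glue hypotheses of the reference data on the disc of offsets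
`{a² + b² < ρ_b²}`, hence the reference tube is a local diffeomorphism there
(`FP.isLocalDiffeomorphAt_tubeD_ref`).

Everything is proved; no named facts.

## References

* R. E. Gompf, *More Cappell–Shaneson spheres are standard*, Algebr. Geom. Topol. 10 (2010)
  1665–1681, proof of Thm 2.1 and Lemma 2.2. [GompfAGT2010]
-/

noncomputable section

open scoped Real Topology ContDiff Manifold
open Set Filter Complex

namespace Literature.Topology.FourManifolds

local notation "𝔼 " n:arg => EuclideanSpace ℝ (Fin n)

/-! ### The leg piece without un-shearing -/

section LegZero

variable {ε : ℝ} (hε : 0 < ε) (hε2 : ε ≤ 1 / 2)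

/-- **The leg tube map with `μ = 0`, `c = 1`** as a diffeomorphism of `ℝ⁴`:
`(r, ϑ, a, b) ↦ (n_j + re (e^{iϑ} w), y_h + im (e^{iϑ} w), ϑ, 1 + h (r - L))`. [folklore] -/
def legZero (nj yh L : ℝ) : (ℝ × ℝ × ℝ × ℝ) ≃ₘ⟮𝓘(ℝ, ℝ × ℝ × ℝ × ℝ), 𝓘(ℝ, ℝ × ℝ × ℝ × ℝ)⟯ (ℝ × ℝ × ℝ × ℝ) where
  toFun q := (nj + (rotAB q.2.1 q.2.2.1 q.2.2.2).2, yh - (rotAB q.2.1 q.2.2.1 q.2.2.2).1, q.2.1, 1 + bxH * (q.1 - L))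
  invFun p := (L + (p.2.2.2 - 1) / bxH, p.2.2.1, (rotABInv p.2.2.1 (yh - p.2.1, p.1 - nj)).1, (rotABInv p.2.2.1 (yh - p.2.1, p.1 - nj)).2)
  left_inv q := by
    obtain ⟨r, ϑ, a, b⟩ := q
    have h := rotABInv_rotAB ϑ a b
    simp only [sub_sub_cancel, add_sub_cancel_left, Prod.mk.eta] at h ⊢
    rw [h]
    exact Prod.ext (by simp [bxH]; ring) rfl
  right_inv p := by
    obtain ⟨n, y, ϑ, t⟩ := p
    have h := rotAB_rotABInv ϑ (yh - y, n - nj)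
    simp only at h ⊢
    rw [h]
    refine Prod.ext (by simp) (Prod.ext (by simp) (Prod.ext (by simp) (by simp [bxH]; ring)))
  contMDiff_toFun := contMDiff_iff_contDiff.2 (show ContDiff ℝ ∞ (fun q : ℝ × ℝ × ℝ × ℝ ↦
      (nj + (rotAB q.2.1 q.2.2.1 q.2.2.2).2, yh - (rotAB q.2.1 q.2.2.1 q.2.2.2).1, q.2.1, 1 + bxH * (q.1 - L))) by
    unfold rotAB; fun_prop)
  contMDiff_invFun := contMDiff_iff_contDiff.2 (show ContDiff ℝ ∞ (fun p : ℝ × ℝ × ℝ × ℝ ↦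
      (L + (p.2.2.2 - 1) / bxH, p.2.2.1, (rotABInv p.2.2.1 (yh - p.2.1, p.1 - nj)).1, (rotABInv p.2.2.1 (yh - p.2.1, p.1 - nj)).2)) by
    unfold rotABInv; fun_prop)

/-- The leg tube map with `μ = 0`, `c = 1` is the diffeomorphism `legZero`. [folklore] -/
theorem legTubeMap_zero (L nj yh : ℝ) (q : ℝ × ℝ × ℝ × ℝ) :
    legTubeMap (fun _ ↦ (0 : ℝ)) 1 L nj yh q = legZero nj yh L q := by
  obtain ⟨h1, h2⟩ := re_im_rot q.2.1 q.2.2.1 q.2.2.2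
  simp only [legTubeMap, legT, h1, h2, mul_zero, add_zero, one_mul]
  rfl

/-- **The leg piece of the reference data is a local diffeomorphism at every offset** with
`0 < t < 3/2`, `n ≠ 0`, `|n| < 2π`. [folklore] -/
theorem isLocalDiffeomorphAt_pieceU1_zero {L nj yh : ℝ} {q : ℝ × ℝ × ℝ × ℝ}
    (ht0 : 0 < (legZero nj yh L q).2.2.2) (ht1 : (legZero nj yh L q).2.2.2 < 3 / 2)
    (hn0 : (legZero nj yh L q).1 ≠ 0) (hn1 : |(legZero nj yh L q).1| < 2 * π) :
    IsLocalDiffeomorphAt 𝓘(ℝ, ℝ × ℝ × ℝ × ℝ) 𝓘(ℝ, 𝔼 4) ∞ (pieceU1 hε hε2 nj yh 1 L fun _ ↦ 0) q := by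
  have hfun : pieceU1 hε hε2 nj yh 1 L (fun _ ↦ 0) = fun q ↦ physX hε hε2 (legZero nj yh L q) := by
    funext q; rw [pieceU1, legTubeMap_zero]
  rw [hfun]
  exact ((legZero nj yh L).isLocalDiffeomorph q).comp (K := 𝓘(ℝ, 𝔼 4)) (P := (fishNu hε hε2).Surgered)
    (isLocalDiffeomorphAt_physX hε hε2 ht0 ht1 hn0 hn1)

end LegZero

namespace FP

variable {ε : ℝ} (hε : 0 < ε) (hε2 : ε ≤ 1 / 2)

/-- The reference data are `fishTgen` with `c = 1`, `ρ_b = L_c`, `μ = 0`. [folklore] -/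
theorem fishTref_eq : fishTref ε hε hε2 = fishTgen ε hε hε2 1 (Lc ε) fun _ ↦ 0 := rfl

include hε2 in
/-- **Window U1 of the reference tube** at any offset in the disc, beyond `s₇ - η`. [folklore] -/
theorem ldU1_ref {q : ℂ × ℝ × ℝ} (hq : q.2 ∈ DiscP ε hε hε2) (h : (fishTref ε hε hε2).s₇ - eta ε < ‖q.1‖)
    (h' : ‖q.1‖ < Rdisc ε + 1) :
    IsLocalDiffeomorphAt 𝓘(ℝ, ℂ × ℝ × ℝ) 𝓘(ℝ, 𝔼 4) ∞ (fishTref ε hε hε2).winU1 q := by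
  set T := fishTref ε hε hε2 with hT
  have es₇ : T.s₇ = s7 ε := rfl
  rw [es₇] at h
  have hη := eta_lt hε hε2
  have htan := tan_beta7_ge (ε := ε); have htan' := (tan_beta7_bounds ε).2
  obtain ⟨hq1, hq2⟩ := sqrt_three_bounds
  obtain ⟨hi1, hi2⟩ := inv_sqrt_three_bounds
  obtain ⟨hs, ha, hb⟩ := disc_bounds hε2 hq
  have hρ := rhoB_le hε hε2; have hρε := rhoB_le_eps hε hε2; have hρ0 := rhoB_pos hε hε2
  have hw1 : s7 ε - 3 / 100 < ‖q.1‖ := by linarith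
  have hd : q.1 ≠ 0 := fun h0 ↦ by rw [h0, norm_zero] at hw1; linarith [s7_gt ε hε]
  have hper : ∀ n ϑ (w : ℝ × ℝ), pieceU1 T.hε T.hε2 T.nj T.yh T.cL T.ρbL T.μL (n, ϑ + 2 * π, w) =
      pieceU1 T.hε T.hε2 T.nj T.yh T.cL T.ρbL T.μL (n, ϑ, w) := fun n ϑ w ↦ pieceU1_add_two_pi T.hε T.hε2 (n, ϑ, w)
  have hcρ : (1 : ℝ) * Lc ε = Lc ε := one_mul _
  have hposf : ∀ᶠ t in 𝓝 ‖q.1‖, ContDiffAt ℝ ∞ T.posL t := by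
    filter_upwards [Ioi_mem_nhds hw1] with t ht using (deriv_posL_pos hε hε2 (c := 1) (ρb := Lc ε) (μ := fun _ ↦ 0) hcρ ht).2
  refine isLocalDiffeomorphAt_radialForm hper hd hposf (deriv_posL_pos hε hε2 (c := 1) (ρb := Lc ε) (μ := fun _ ↦ 0) hcρ hw1).1.ne' ?_
  -- the range of the leg position: `L - 1/4 < posL r < r ≤ …`
  set r' := T.posL ‖q.1‖ with hr'
  have hβ : -(π / 2) < angleDown (rone ε) ‖q.1‖ ∧ angleDown (rone ε) ‖q.1‖ < 0 := by
    unfold s7 at hw1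
    exact ⟨(angleDown_mem _ _).1, by rw [← angleDown_add_inv_sqrt_three (rone ε)]; exact strictAnti_angleDown _ (by linarith)⟩
  have htβ : Real.tan (angleDown (rone ε) ‖q.1‖) < 0 := by
    have := Real.tan_lt_tan_of_lt_of_lt_pi_div_two hβ.1 (by linarith [Real.pi_pos]) hβ.2
    rwa [Real.tan_zero] at this
  -- `tan β > -(r - r₁)·3/2 …`: we only need `rL (β r) < r + 1`, from `tan β ≥ -3`: `β > -arctan 3`… use `β ≥ β(R+1)`
  have hr'mem : Lc ε - 1 / 4 < r' ∧ r' < Lc ε + 2 := by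
    have hf : T.rL (angleDown (rone ε) ‖q.1‖) = 1 * Lc ε - 1 / 4 - Real.tan (angleDown (rone ε) ‖q.1‖) := rL_eq hε hε2 _
    rw [hr', show T.posL = blendFun (stdBlend (a8 ε) (b8 ε)) (fun r ↦ T.rL (angleDown (rone ε) r)) fun r ↦ r from rfl, blendFun, hf]
    have hχ := stdBlend_mem (a8 ε) (b8 ε) ‖q.1‖
    -- `-tan β < 3`: `β > β(s₇ + 2) ≥ π/4 - (3/2) arctan (1/√3 + 2.1) > -arctan 3`… we use the crude `tan β > -(‖q.1‖ - r₁) - 1`-free bound: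
    -- since `β ∈ (-π/2, 0)` and `r ≤ R + 1 = s₇ + 2`, `β ≥ π/4 - (3/2) arctan (r - r₁) ≥ π/4 - 3π/4 = -π/2`; instead bound
    -- `-tan β` via `rL` monotonicity is overkill; we use `tan β ≥ tan (β (s₇ + 2))` and `β(s₇+2) ≥ π/4 - 3/2·arctan(2.71) > -1.2`.
    have hlow : Lc ε - 1 / 4 < 1 * Lc ε - 1 / 4 - Real.tan (angleDown (rone ε) ‖q.1‖) := by linarith
    have hLr : Lc ε - 1 / 4 < ‖q.1‖ := by unfold Lc; linarith
    have htan3 : -(20 / 9) ≤ Real.tan (angleDown (rone ε) ‖q.1‖) := by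
      -- `β ≥ β (r₁ + 3) = π/4 - (3/2) arctan 3 > -arctan 3` since `arctan 3 < 5π/... `; simpler: `β > -π/2 + (3/2) arctan (1/3)`
      have hle : angleDown (rone ε) (rone ε + 3) ≤ angleDown (rone ε) ‖q.1‖ := by
        refine (strictAnti_angleDown _).antitone ?_
        unfold Rdisc s7 at h'; linarith
      have hval : angleDown (rone ε) (rone ε + 3) = -(π / 2) + 3 / 2 * Real.arctan 3⁻¹ := by
        rw [angleDown, add_sub_cancel_left, Real.arctan_inv_of_pos (by norm_num : (0:ℝ) < 3)] at *
        · ring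
      have hA : 3 / 10 ≤ Real.arctan (3 : ℝ)⁻¹ := by
        have := div_one_add_sq_le_arctan (x := (3 : ℝ)⁻¹) (by norm_num)
        norm_num at this ⊢; linarith
      have hy0 : 0 < 3 / 2 * Real.arctan (3 : ℝ)⁻¹ := by linarith
      have hy2 : 3 / 2 * Real.arctan (3 : ℝ)⁻¹ < π / 2 := by
        have := IwaseTori.arctan_le_self (x := (3 : ℝ)⁻¹) (by norm_num); norm_num at this; linarith [Real.pi_gt_three]
      have h1 : Real.tan (angleDown (rone ε) (rone ε + 3)) ≤ Real.tan (angleDown (rone ε) ‖q.1‖) := by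
        rcases hle.lt_or_eq with hlt | heq
        · exact (Real.tan_lt_tan_of_lt_of_lt_pi_div_two (angleDown_mem _ _).1 (by linarith [Real.pi_pos]) hlt).le
        · rw [heq]
      have h2 : -(3 / 2 * Real.arctan (3 : ℝ)⁻¹)⁻¹ ≤ Real.tan (angleDown (rone ε) (rone ε + 3)) := by
        rw [hval, show -(π / 2) + 3 / 2 * Real.arctan (3 : ℝ)⁻¹ = 3 / 2 * Real.arctan (3 : ℝ)⁻¹ - π / 2 by ring]
        exact neg_inv_le_tan_sub_pi_div_two hy0 hy2
      have h3 : (3 / 2 * Real.arctan (3 : ℝ)⁻¹)⁻¹ ≤ 20 / 9 := by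
        rw [inv_le_comm₀ hy0 (by norm_num)]; linarith
      linarith
    have hhigh : 1 * Lc ε - 1 / 4 - Real.tan (angleDown (rone ε) ‖q.1‖) < Lc ε + 2 := by linarith
    have hr2 : ‖q.1‖ < Lc ε + 2 := by unfold Rdisc at h'; unfold Lc; linarith
    exact convex_combo_mem_Ioo hχ.1 hχ.2 ⟨hlow, hhigh⟩ ⟨hLr, hr2⟩
  have hnj : nj ε = -(9 * ε / 10) := rfl
  obtain ⟨hr1, hr2⟩ := abs_rotAB_le (arg q.1) q.2.1 q.2.2
  refine isLocalDiffeomorphAt_pieceU1_zero T.hε T.hε2 ?_ ?_ ?_ ?_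
  · show 0 < 1 + bxH * (r' - Lc ε); rw [bxH]; linarith [hr'mem.1]
  · show 1 + bxH * (r' - Lc ε) < 3 / 2
    rw [bxH]; linarith [hr'mem.2]
  · show nj ε + (rotAB (arg q.1) q.2.1 q.2.2).2 ≠ 0
    have := (abs_le.1 (hr2.trans hs.le)).2; rw [hnj]; linarith
  · show |nj ε + (rotAB (arg q.1) q.2.1 q.2.2).2| < 2 * π
    have := abs_le.1 (hr2.trans hs.le); rw [hnj, abs_lt]; constructor <;> linarith [Real.pi_gt_three]

include hε2 in
/-- **The glue hypotheses of the reference data on the disc of offsets.** [folklore] -/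
theorem glueHypRef : (fishTref ε hε hε2).GlueHyp (eta ε) (Rdisc ε + 1) (DiscP ε hε hε2) := by
  set T := fishTref ε hε hε2 with hT
  have hη0 := eta_pos ε hε
  have hη := eta_lt hε hε2
  obtain ⟨hs21, hs22⟩ := s2_bounds hε hε2
  obtain ⟨hi1, hi2⟩ := inv_sqrt_three_bounds
  obtain ⟨hq1, hq2⟩ := sqrt_three_bounds
  have hρ0 := rhoB_pos hε hε2
  have hr0 : rzero ε = 12 + ε / 100 := by unfold rzero b2; ring
  have es₁ : T.s₁ = 3 / 4 := rfl
  have es₂ : T.s₂ = s2 ε := rfl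
  have es₃ : T.s₃ = s3 ε := rfl
  have es₄ : T.s₄ = s4 ε := rfl
  have es₅ : T.s₅ = s5 ε := rfl
  have es₆ : T.s₆ = s6 ε := rfl
  have es₇ : T.s₇ = s7 ε := rfl
  have hc : Continuous fun w : ℝ × ℝ ↦ w.1 ^ 2 + w.2 ^ 2 := by fun_prop
  exact
    { hη := hη0
      hAdm := isOpen_lt hc continuous_const
      h01 := by rw [es₁]; linarith
      h12 := by rw [es₁, es₂]; linarith
      h23 := by rw [es₂, es₃]; unfold s3; rw [hr0]; linarith
      h34 := by rw [es₃, es₄]; unfold s3 s4; linarith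
      h45 := by rw [es₄, es₅]; unfold s4 s5; linarith
      h56 := by rw [es₅, es₆]; unfold s5 s6 rone; linarith
      h67 := by
        rw [es₆, es₇]; unfold s6 s7
        have : 0 < 1 / Real.sqrt 3 := by positivity
        linarith
      h7 := by rw [es₇]; unfold Rdisc; linarith
      ag₁ := fun q _ h ↦ ag1_holds hε2 h
      ag₂ := fun q _ h ↦ ag2_holds hε2 h
      ag₃ := fun q _ h ↦ ag3_holds hε2 h
      ag₄ := fun q _ h ↦ ag4_holds hε2 h
      ag₅ := fun q _ h ↦ ag5_holds hε2 h
      ag₆ := fun q _ h ↦ ag6_holds hε2 h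
      ag₇ := fun q _ h ↦ ag7_holds hε2 (one_mul _) (fun _ _ ↦ rfl) h
      ldS := fun q hq h ↦ ldS_holds hε2 hq h
      ldA := fun q hq h h' ↦ ldA_holds hε2 hq h h'
      ldN := fun q hq h h' ↦ ldN_holds hε2 hq h h'
      ldU5 := fun q hq h h' ↦ ldU5_holds hε2 hq h h'
      ldU4 := fun q hq h h' ↦ ldU4_holds hε2 hq h h'
      ldU3 := fun q hq h h' ↦ ldU3_holds hε2 hq h h'
      ldU2 := fun q hq h h' ↦ ldU2_holds hε2 hq h h'
      ldU1 := fun q hq h h' ↦ ldU1_ref hε hε2 hq h h' }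

include hε2 in
/-- **The reference tube is a local diffeomorphism** at offsets in the disc and positions below
`R + 1`. [folklore] -/
theorem isLocalDiffeomorphAt_tubeD_ref {q : ℂ × ℝ × ℝ} (hq : q.2 ∈ DiscP ε hε hε2) (hr : ‖q.1‖ < Rdisc ε + 1) :
    IsLocalDiffeomorphAt 𝓘(ℝ, ℂ × ℝ × ℝ) 𝓘(ℝ, 𝔼 4) ∞ (fishTref ε hε hε2).tubeD q :=
  (fishTref ε hε hε2).isLocalDiffeomorphAt_tubeD (glueHypRef hε hε2) hq hr

end FP

end Literature.Topology.FourManifolds
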